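import Summits.QuantumFields.YangMills.Theorems.BalabanUVNodesK0Stub1RecordAveragingRightInverse
import Summits.QuantumFields.YangMills.Theorems.UnitScaleTiltProp8ChartHInvGradBridge
import HarnessLib

/-!
# K0⁷ STUB 1 (`stub_prop8StepCoP13`), sub-target S4b — THE CHART BLOCK OF THE SECT. F CAPSTONE AT THE RECORD, part 7:
# **THE RIGHT INVERSE `H` OF THE TRUE LINEARISED CONSTRAINT WITH BOTH (46) ROWS** — dag k0-s1-w1's `exists_rightInverse_chartLog_of_flatH` (p604736: sup row only) re-run
# through the route `UnitScaleTilt`'s two-row bridge `ChartHInv.exists_rightInverse₂`, so that the GRADIENT row «|∇HB| ≤ B₀(Lʲη)⁻²|B|» of (46) is exported too — the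
# hypothesis `hHgrad` of part 6 (`K0Stub1SectFWSlotAtRecord.exists_sectF_W_atRecord_of_numericLetters`), with which (58) is a theorem there

Cell `pub-ymgap`, width seat `pub-ymgap-k0-s1-w2` g3 (INTENT-7).  `--kind proof --supports stmt-QuantumFields-20541 --as helper`; count-neutral.
[15] = [Balaban1985Variational]; [B6] = [Balaban1984PropagatorsII].

WHY.  Print (46) p. 285 has TWO rows: «|HB| ≤ B₀(Lʲη)⁻¹|B|, |∇HB| ≤ B₀(Lʲη)⁻²|B| on Ω_j».  The capstone's (57)–(58) letter `ℓ` (both sizes of the chart point `A′ − HD(A′)`)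
needs the second row; dag k0-s1-w1's record wrapper exported the first only (its bus note: «the gradient row of (46) … NOT carried here»), while k0-s1-w3's P2 letter
`HSupLetterG P k D w H₀ B₀` of the flat `H₀` CARRIES both rows and UST's `exists_rightInverse₂` transports both through the comb∕tent correction `HX = H₀X̃′ + ∂φ`.
THIS FILE is the two-row wrapper, same proof shape as p604736 (UST bridge + `bondAvgIter_of_isFlatH` + `Prop8Chart.fderiv_chartLog_zero_apply`; dag k0-s1-w1's
`exists_rightInverse_chartLog_of_flatH` ∕ `exists_suRightInverse_qLin_one` are the one-row and the 𝔰𝔲(N)-valued editions), nothing of theirs restated (bus word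
«YOURS, no MINE», k0-s1-w1 g4, 2026-08-28 ≈07:3xZ).

WHAT IS PROVED (sorry-free; no definition; axioms standard).
* ★★ `exists_rightInverse_chartLog_of_flatH₂` — `(P, k)`, nested family `D` with `D.k = k`, `Adm22 D R M`, `2L ≤ R·M + 1`, weights `IsLevWeight P k D w`, flat `H₀` with
  `IsFlatH P k D H₀` and `HSupLetterG P k D w H₀ B₀` (`B₀ ≥ 0`), any matrix fibre `M_n(ℂ)`: a ℂ-linear `H` with `D(chartLog L^{−k} D)(0) ∘ H = id`,
  the sup row `w 1 b·‖HX b‖ ≤ B₀(1+2ℓ₀)(1+8ℓ₀+8ℓ₀L)·t` and the GRADIENT row `w 2 b·L^k·‖HX(b+ν) − HX b‖ ≤ B₀(1+2ℓ₀)(1+256ℓ₀L⁴)·t` for `‖X i‖ ≤ t`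
  (`ℓ₀ = (d+2)L`) — exactly the binders `H hHinv hHB hHgrad` of part 6.
* ★★ `exists_rightInverse_chartLog_of_adm22_T4₂` — the record edition at P9's thresholds (twin of k0-s1-w1's `…_of_adm22_T4`, both rows, no displayed operator letter).
HONEST SCOPE.  A wrapper of kernel-checked theorems; the constants are UST's (k-uniform); nothing of [15]'s analysis asserted; `stub_prop8StepCoP13` ∕ K0⁷ NOT closed; N07 NOT
discharged; counts unmoved (28∕28 · 5∕27); one finite 𝕋⁴ programme at fixed ε — R4 closes the conditional finite-𝕋⁴ rung `BalabanLadder.UV` only, never the summit; the YM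
mass gap (Clay) is NOT proved by any of this; nothing continuum ∕ ℝ⁴ ∕ OS.  No `sorry`, no `def`, no `instance`, no `notation`.

References: [15] (45)–(47) p.285, (57)–(58) pp.286–287, (156)–(157) p.302; [B6] (2.2) p.224, (2.35) p.228, Cor. 2.8 (2.150)–(2.151) p.249.
-/

set_option autoImplicit false
noncomputable section
open scoped BigOperators Matrix Matrix.Norms.L2Operator

namespace Summit.QuantumFields.YangMills.Theorems.K0Stub1RecordAveragingRightInverseGrad

open Literature.MathematicalPhysics.QuantumFieldTheory.Balaban1983to89
open LatticeFieldCalculus (bondAvgIter)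
open B6SectADomainsV1 (Domains)
open B6SectAOperatorsV1 (BondIdx)
open B11Eq115Space (levOf)
open Summit.QuantumFields.YangMills.Theorems.ChartHInv (exists_linFamily exists_rightInverse₂)
open Summit.QuantumFields.YangMills.Theorems.Prop8Chart (chartLog fderiv_chartLog_zero_apply)
open Summit.QuantumFields.YangMills.Theorems.FlatCubeOpsText (Adm22)
open Summit.QuantumFields.YangMills.Theorems.K0FlatCubeOpsTextP (IsFlatH HSupLetterG IsLevWeight)
open Summit.QuantumFields.YangMills.Theorems.K0Stub1RecordAveragingRightInverse (bondAvgIter_of_isFlatH)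
open Summit.QuantumFields.YangMills.Theorems.K0FlatPortBodyP (body_of_adm22_T4)
open Literature.MathematicalPhysics.QuantumFieldTheory.Balaban1983to89.T4Continuum (T4Family)

variable {P : Params}

/-- ★★ **THE RIGHT INVERSE OF THE TRUE LINEARISATION WITH BOTH (46) ROWS, GENERIC CARRIER.**  For a nested family `D` with `D.k = k`, (2.2)-admissible with
`2L ≤ R·M + 1`, the level weights `w` (`IsLevWeight P k D w`), and P2's flat operator `H₀` (`IsFlatH P k D H₀`) with its guarded two-row letter `HSupLetterG P k D w H₀ B₀`
(`B₀ ≥ 0`): a ℂ-linear right inverse `H` of `fderiv ℂ (chartLog L^{−k} D) 0` on `M_n(ℂ)`-valued data with the SUP row `w 1 b·‖HX b‖ ≤ B₀(1+2ℓ₀)(1+8ℓ₀+8ℓ₀L)·t` and the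
GRADIENT row `w 2 b·L^k·‖HX(b+ν) − HX b‖ ≤ B₀(1+2ℓ₀)(1+256ℓ₀L⁴)·t` whenever `‖X i‖ ≤ t` (`ℓ₀ = (d+2)L`) — «|HB| ≤ B₀(Lʲη)⁻¹|B|, |∇HB| ≤ B₀(Lʲη)⁻²|B|» (46), both rows, for
the corrected `H` of the route `UnitScaleTilt`'s bridge `ChartHInv.exists_rightInverse₂`. [cite: Balaban1985Variational, (45)-(46) p.285, (156)-(157) p.302; Balaban1984PropagatorsII, (2.35) p.228, Cor. 2.8 p.249] -/
theorem exists_rightInverse_chartLog_of_flatH₂ {n : Type*} [Fintype n] [DecidableEq n] (k : ℕ) (D : Domains P) (hDk : D.k = k) {R M : ℕ}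
    (hAdm : Adm22 D R M) (hRM : 2 * P.L ≤ R * M + 1) (w : ℕ → PBond P 0 → ℝ) (hw : IsLevWeight P k D w)
    (H₀ : (BondIdx D → ℝ) →ₗ[ℝ] (PBond P 0 → ℝ)) (hH₀ : IsFlatH P k D H₀) {B₀ : ℝ} (hB₀ : 0 ≤ B₀) (hsup : HSupLetterG P k D w H₀ B₀) :
    ∃ H : (BondIdx D → Matrix n n ℂ) →ₗ[ℂ] (PBond P 0 → Matrix n n ℂ),
      (∀ X : BondIdx D → Matrix n n ℂ,
          (fderiv ℂ (chartLog (((P.L : ℝ)⁻¹) ^ k) D : (PBond P 0 → Matrix n n ℂ) → BondIdx D → Matrix n n ℂ) 0) (H X) = X) ∧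
      (∀ (X : BondIdx D → Matrix n n ℂ) (t : ℝ), 0 ≤ t → (∀ i, ‖X i‖ ≤ t) → ∀ b,
        w 1 b * ‖H X b‖ ≤ B₀ * ((1 + 2 * ((P.d + 2) * P.L : ℕ)) * (1 + 8 * ((P.d + 2) * P.L : ℕ) + 8 * ((P.d + 2) * P.L : ℕ) * P.L)) * t) ∧
      (∀ (X : BondIdx D → Matrix n n ℂ) (t : ℝ), 0 ≤ t → (∀ i, ‖X i‖ ≤ t) → ∀ (b : PBond P 0) (ν : Fin P.d),
        w 2 b * (P.L : ℝ) ^ k * ‖H X ⟨b.src.shift ν, b.dir⟩ - H X b‖ ≤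
          B₀ * ((1 + 2 * ((P.d + 2) * P.L : ℕ)) * (1 + 256 * ((P.d + 2) * P.L : ℕ) * (P.L : ℝ) ^ 4)) * t) := by
  obtain ⟨Q, hQ0, hQs⟩ := exists_linFamily (P := P) (n := n)
  have hη : 0 < ((P.L : ℝ)⁻¹) ^ k := by have := P.L_pos; positivity
  have hηinv : (((P.L : ℝ)⁻¹) ^ k)⁻¹ = (P.L : ℝ) ^ k := by rw [inv_pow, inv_inv]
  have hw₁ : ∀ b : PBond P 0, w 1 b = (P.L : ℝ) ^ levOf (fun i => {z : Site P 0 | D.InOm i z}) D.k b.src * ((P.L : ℝ)⁻¹) ^ k := by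
    intro b; rw [hw 1 b, pow_one, hDk]
  have hw₂ : ∀ b : PBond P 0, w 2 b = ((P.L : ℝ) ^ levOf (fun i => {z : Site P 0 | D.InOm i z}) D.k b.src * ((P.L : ℝ)⁻¹) ^ k) ^ 2 := by
    intro b; rw [hw 2 b, hDk]
  -- the two rows of the flat `H₀` (k0-s1-w3's guarded letter), the gradient row read with `η⁻¹ = L^k`
  have hsup₁ : ∀ (Xr : BondIdx D → ℝ) (t : ℝ), 0 ≤ t → (∀ i, ((P.L : ℝ) ^ (i.1.1 : ℕ) * ((P.L : ℝ)⁻¹) ^ k) * |Xr i| ≤ t) →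
      ∀ b, w 1 b * |H₀ Xr b| ≤ B₀ * t := fun Xr t ht hXr => (hsup Xr t ht hXr).1
  have hgrad₁ : ∀ (Xr : BondIdx D → ℝ) (t : ℝ), 0 ≤ t → (∀ i, ((P.L : ℝ) ^ (i.1.1 : ℕ) * ((P.L : ℝ)⁻¹) ^ k) * |Xr i| ≤ t) →
      ∀ (b : PBond P 0) (ν : Fin P.d), w 2 b * (((P.L : ℝ)⁻¹) ^ k)⁻¹ * |H₀ Xr ⟨b.src.shift ν, b.dir⟩ - H₀ Xr b| ≤ B₀ * t := by
    intro Xr t ht hXr b ν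
    rw [hηinv]
    exact (hsup Xr t ht hXr).2 b ν
  obtain ⟨H, hinvC, hlet, hgrad⟩ := exists_rightInverse₂ (n := n) D hAdm hRM hη (w 1) hw₁ (w 2) hw₂ H₀ (bondAvgIter_of_isFlatH k D H₀ hH₀) hB₀
    hsup₁ hgrad₁ Q hQ0 hQs
  refine ⟨H, fun X => funext fun idx => ?_, fun X t ht hX b => hlet X t ht hX b, fun X t ht hX b ν => ?_⟩
  · rw [fderiv_chartLog_zero_apply _ D Q hQ0 hQs]
    exact hinvC X idx
  · have h := hgrad X t ht hX b ν
    rwa [hηinv] at h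

/-! ## §2  At NODE 00's record: P9's thresholds, both rows, no displayed operator letter -/

/-- ★★ **THE TWO-ROW RIGHT INVERSE AT THE RECORD (P9's thresholds)** — the twin of dag k0-s1-w1's `exists_rightInverse_chartLog_of_adm22_T4` with the GRADIENT row: there
are `Mh₀ R₀ : ℕ` and `B₀ ≥ 0` such that every nested family `D` on `Site (F.P K) 0` of top level `K − n` (`1 ≤ K − n`, `K − n + 1 ≤ m + K`) with `Adm22 D R (L·M_h)`,
`M_h = L^{a′} ≥ Mh₀`, `R ≥ max R₀ 2`, `a′ + 3 ≤ m + n`, and its level weights `w`, carries a ℂ-linear right inverse `H` of `fderiv ℂ (chartLog L^{−(K−n)} D) 0` on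
`M_n(ℂ)`-valued data with the sup row `B₀(1+2ℓ₀)(1+8ℓ₀+8ℓ₀L)` and the gradient row `B₀(1+2ℓ₀)(1+256ℓ₀L⁴)` (`ℓ₀ = 6L` at d = 4) — the binders `H hHinv hHB hHgrad` of
`K0Stub1SectFWSlotAtRecord.exists_sectF_W_atRecord_of_numericLetters` at every served family of the record, by `exact` (k0-s1-w3's port P9 `body_of_adm22_T4` supplies
`IsFlatH` + `HSupLetterG`). [cite: Balaban1985Variational, (45)-(46) p.285, (156)-(157) p.302; Balaban1984PropagatorsII, (2.1)-(2.2) p.224, Cor. 2.8 (2.150)-(2.151) p.249] -/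
theorem exists_rightInverse_chartLog_of_adm22_T4₂ {n : Type*} [Fintype n] [DecidableEq n] (F : T4Family) :
    ∃ (Mh₀ R₀ : ℕ) (B₀ : ℝ), 0 ≤ B₀ ∧ ∀ (n' K : ℕ) (_ : 1 ≤ K - n') (_ : K - n' + 1 ≤ F.m + K) {Mh R a' : ℕ} (_ : Mh = F.L ^ a') (_ : Mh₀ ≤ Mh) (_ : max R₀ 2 ≤ R)
      (_ : a' + 3 ≤ F.m + n') (D : Domains (F.P K)) (_ : D.k = K - n') (_ : Adm22 D R (F.L * Mh))
      (w : ℕ → PBond (F.P K) 0 → ℝ) (_ : IsLevWeight (F.P K) (K - n') D w),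
      ∃ H : (BondIdx D → Matrix n n ℂ) →ₗ[ℂ] (PBond (F.P K) 0 → Matrix n n ℂ),
        (∀ X : BondIdx D → Matrix n n ℂ,
            (fderiv ℂ (chartLog (((F.L : ℝ)⁻¹) ^ (K - n')) D : (PBond (F.P K) 0 → Matrix n n ℂ) → BondIdx D → Matrix n n ℂ) 0) (H X) = X) ∧
        (∀ (X : BondIdx D → Matrix n n ℂ) (t : ℝ), 0 ≤ t → (∀ i, ‖X i‖ ≤ t) → ∀ b,
          w 1 b * ‖H X b‖ ≤ B₀ * ((1 + 2 * ((4 + 2) * F.L : ℕ)) * (1 + 8 * ((4 + 2) * F.L : ℕ) + 8 * ((4 + 2) * F.L : ℕ) * F.L)) * t) ∧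
        (∀ (X : BondIdx D → Matrix n n ℂ) (t : ℝ), 0 ≤ t → (∀ i, ‖X i‖ ≤ t) → ∀ (b : PBond (F.P K) 0) (ν : Fin (F.P K).d),
          w 2 b * (F.L : ℝ) ^ (K - n') * ‖H X ⟨b.src.shift ν, b.dir⟩ - H X b‖ ≤
            B₀ * ((1 + 2 * ((4 + 2) * F.L : ℕ)) * (1 + 256 * ((4 + 2) * F.L : ℕ) * (F.L : ℝ) ^ 4)) * t) := by
  obtain ⟨Mh₀, R₀, B₀, δ₀, B₃, -, -, hmain⟩ := body_of_adm22_T4 F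
  refine ⟨Mh₀, R₀, max B₀ 0, le_max_right _ _, ?_⟩
  intro n' K hk1 hk' Mh R a' hMha hMh hR hsize D hDk hAdm w hw
  obtain ⟨H₀, Gt, hH₀, -, hHsup, -, -, -⟩ := hmain n' K hk1 hk' hMha hMh ((le_max_left _ _).trans hR) hsize D hDk hAdm w hw
  have hLpos : 0 < F.L := (F.P K).L_pos
  have hRM : 2 * (F.P K).L ≤ R * (F.L * Mh) + 1 := by
    have hR2 : 2 ≤ R := (le_max_right _ _).trans hR
    have hMh1 : 1 ≤ Mh := by rw [hMha]; exact Nat.one_le_pow _ _ hLpos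
    have h1 : F.L ≤ F.L * Mh := Nat.le_mul_of_pos_right _ hMh1
    have h2 : 2 * (F.L * Mh) ≤ R * (F.L * Mh) := Nat.mul_le_mul_right _ hR2
    show 2 * F.L ≤ R * (F.L * Mh) + 1
    omega
  have hsup' : HSupLetterG (F.P K) (K - n') D w H₀ (max B₀ 0) := K0FlatCubeOpsTextP.hSupLetterG_mono hHsup (le_max_left _ _)
  exact exists_rightInverse_chartLog_of_flatH₂ (P := F.P K) (K - n') D hDk hAdm hRM w hw H₀ hH₀ (le_max_right _ _) hsup'

end Summit.QuantumFields.YangMills.Theorems.K0Stub1RecordAveragingRightInverseGrad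

end
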